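import Literature.MathematicalPhysics.QuantumFieldTheory.Balaban1983to89.B5Eq190FlatStrongFormTransfer
import Literature.MathematicalPhysics.QuantumFieldTheory.Balaban1983to89.B9Eq373DerivativeRemainderL2
import Literature.MathematicalPhysics.QuantumFieldTheory.Balaban1983to89.B9Eq368ProjectionRemainder

/-!
# `Balaban1983to89.B9Eq382FormRelativeNearFlat` — T. Bałaban, *Propagators for lattice gauge theories in a background field*, Commun. Math. Phys.
# **99** (1985) 389–434 [Balaban1985BackgroundPropagators] (3.82)–(3.86) p. 407 ∕ Thm 3.11 p. 416, with *Propagators and renormalization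
# transformations I* [Balaban1984PropagatorsI] (1.69) p. 29 ∕ Prop. 1.1 (1.90) p. 33: THE SECOND HALF OF THM 3.11 FOR THE pub-balaban NE9 CHAIN BY
# **FORM-RELATIVE** (KATO-TYPE) PERTURBATION OFF THE STRONG FLAT FORM — `re⟨x, Δ_a(U)x⟩ ≥ re⟨x, Δ_a(1)x⟩ − θ·(‖D(1)x‖² + ‖D*(1)x‖² + ‖x‖²)` WITH
# `θ` A POLYNOMIAL IN THE FIRST-ORDER LETTER DEFECTS (`‖(D_U − D_1)x‖`, `‖(D*_U − D*_1)x‖`: `‖η⁻¹‖·εR` — NOT `‖η⁻¹‖²·εR`), THE `R`-LETTER `δ_R`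
# AND THE `Q`-LETTERS `δ_Q, M_Q`; COMPOSED WITH (S0) `B5Eq190FlatStrongFormTransfer`: STRONG COERCIVITY AT `U`, `(γ(d,a) − θ)·(…) ≤ re⟨x, Δ_a(U)x⟩`

statement-level skeleton of published theorems with citation tags; proofs where landed; nothing here is a claim about the Yang–Mills mass gap

PDF held: `paper:balaban1985-cmp99-background-propagators` pp. 404–407, 416 via the tree's `B9Thm311SmallFieldCoercivity` ∕ `B9Eq373DerivativeRemainderL2`
docstrings (verbatim there; p0005 of the text layer opened by this seat 2026-08-22); `paper:balaban1984-cmp95-propagators-rt-i` pp. 29, 33 via (F)∕(S0).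

THE PRINT (verbatim).  [B9] p. 407: *«Δ_a(U′U) = Δ_a(U) − V(A) = (I − V(A)G(U))Δ_a(U) (3.84)»*; p. 416: *«Theorem 3.11. Under the assumptions of
the Theorems 3.1–3.10 … the operators Δ′_a, G′, (Q′G′²Q′*)⁻¹, Δ_a, G are positive definite. … In [4] we have proved that the operator G_□(1) is
positive, hence by the same reasoning as above we prove positivity of G_□»*; [B5] p. 29 (1.69): *«⟨A, Δ_a A⟩ = ⟨A, ∂*∂A⟩ + ⟨A, ∂R∂*A⟩ + a⟨A, Q*QA⟩»*,
p. 33 (1.90): *«Δ_a = G⁻¹ ≥ γ₀(Δ + I)»*.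

WHY THIS FILE (cell context).  The NE9 owner's (C2) `B9Thm311SmallFieldCoercivity` and this lineage's (C2′) `…Uniform` run p. 416's mechanism in
OPERATOR norm: `‖(Δ_prin(U) − Δ_prin(1))x‖ ≤ δ‖x‖` against the WEAK flat form `γ₀‖x‖²`; the operator difference is SECOND order in the derivative
letters and carries `‖η⁻¹‖²` (`B9Eq373DerivativeRemainderL2.norm_principal_sub_le`: `16d(2+εR)‖c‖²εR`), which on the diagonal `ηL = 1` makes the
admissible radius `≤ cη³` in print's currency (`t4/ROUTES-NE9.md` v13.19 §L1.2 (i)(b), R2′ STEP B7′).  B7′'s remedy (steps S1∕S4): perturb the QUADRATIC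
FORM instead — by (1.69) `re⟨x, Δ_a(U)x⟩ = ‖D_Ux‖² + ‖R_U D*_U x‖² + a‖Q_Ux‖²` (three squares, §2), and a difference of squares is controlled by the
FIRST-order defects `‖(D_U − D_1)x‖ ≤ 4√d‖η⁻¹‖εR‖x‖`, `‖(D*_U − D*_1)x‖ ≤ √d‖η⁻¹‖εR‖x‖` (`B9Eq373DerivativeRemainderL2.norm_covCurlL2K_sub_le` ∕
`norm_covDivL2K_sub_le`) times the first-order quantities `‖D_1x‖`, `‖D*_1x‖` — which the STRONG flat form (S0) `B5Eq190FlatStrongFormTransfer.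
flat_strong_coercive_canonical` controls.  At transporter closeness `εR = K_R·αη` (print's η-SCALED window (3.35)) `‖η⁻¹‖εR = K_Rα` is η-FREE.
What this file does NOT discharge (DISPLAYED, as (C2) displays its averaging letters): the `R`-letter `δ_R` (`‖(R_U − R_1)y‖ ≤ δ_R‖y‖` — B7′ step S3,
the knot, ne9-leaf-06's) and the `Q`-letters `δ_Q`, `M_Q` ((C2)'s, volume-free by `B9Eq383QSemiLocal` ∕ `B9Eq315QFlatNorm`; η-behaviour = B7′ step S2).

WHAT IS PROVED (sorry-free; 0 `def`; [folklore] Hilbert-space algebra on the chain's letters; no inequality of the papers asserted).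
* §1 (abstract, any `RCLike` inner-product space) **`coercive_of_form_near`** (the Kato step: `γN(x) ≤ re⟨x,T₁x⟩`, `re⟨x,T₁x⟩ − θN(x) ≤ re⟨x,Tx⟩` ⇒
  `(γ−θ)N(x) ≤ re⟨x,Tx⟩`), **`norm_sq_sub_le`** (`‖v‖² − ‖u‖² ≤ ‖u−v‖·(2‖v‖ + ‖u−v‖)`) (+ a private `2st ≤ s² + t²`).
* §2 **`re_inner_principalOpK_eq`** (`re⟨x, D*D(U)x⟩ = ‖D_Ux‖²` under `hRS`), **`re_inner_laplaceA_eq_three_sq`** — (1.69) AT `U`: `re⟨x, Δ_a(U)x⟩ =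
  ‖D_Ux‖² + ‖R_U D*_Ux‖² + a‖Q_Ux‖²` ((F) `re_inner_flat_eq_three_sq` is its `U = 1` case).
* §3 **`re_inner_laplaceA_ge_flat_sub`** — THE FORM-RELATIVE NEAR-FLAT STEP with DISPLAYED letter defects `δ_D, δ_S, δ_R, δ_Q, M_Q`:
  `re⟨x, Δ_a(1)x⟩ − (δ_D‖D_1x‖² + (δ_S + δ_Sδ_R + 2δ_R + δ_R²)‖D*_1x‖² + (δ_D + δ_D² + δ_S + δ_Sδ_R + δ_S² + aδ_Q(2M_Q + δ_Q))‖x‖²) ≤ re⟨x, Δ_a(U)x⟩`.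
* §4 **`re_inner_laplaceA_ge_flat_sub_of_transport`** — `δ_D := 4√d‖η⁻¹‖εR`, `δ_S := √d‖η⁻¹‖εR` DISCHARGED from the transporter closeness
  `‖R(U(b))w − w‖ ≤ εR‖w‖` (`B9Eq373DerivativeRemainderL2`); `δ_R, δ_Q, M_Q` displayed.
* §5 **`strong_coercive_of_form_near_flat_canonical`** — composed with (S0) along `c₁(ηL)² = c₀L^d`, `0 < ηL ≤ 1`:
  `(γ(d,a) − θ)·(‖D_1x‖² + ‖D*_1x‖² + ‖x‖²) ≤ re⟨x, Δ_a(U)x⟩`, `γ(d,a) = 1∕((d+1)Cst d a)`, `θ = θ(‖η⁻¹‖εR, δ_R, δ_Q, M_Q, a, d)` EXPLICIT —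
  B7′-1's SHAPE modulo the two displayed letters; no `‖η⁻¹‖²`, no volume, no threshold `∃` anywhere (an inequality valid for all values of the letters);
  **`coercive_of_form_near_flat_canonical`** — the weak shape `(γ(d,a) − θ)·‖x‖² ≤ re⟨x, Δ_a(U)x⟩` that (C2)∕(C2′) and `hpos_of_principal_coercive` consume.
MODEL ∕ DECLARED READINGS.  (M1) as (C2)∕(C2′)∕(F): one averaging step on `TSite d (L·m)`, weights `c₀, c₁`, scalar `η⁻¹`, reading `φ` of the fibre.
(M2) DISPLAYED: `hRS` (mutual adjointness of the transporters on the fibre), the transporter closeness `εR` (§4; (C2) derives it from `‖U b − 1‖ ≤ ε` as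
`K_Rε`, `B9Eq384RemainderLetters.norm_adTransportW_sub_le` — not repeated here), `δ_R`, `δ_Q`, `M_Q`, the regularity letters of `Q(U)`.  (M3) NOT HERE:
the discharge of `δ_R` (B7′ S3: `R` through (3.25)'s resolvents), of `δ_Q` at `ε = αη` (S2), the curvature part `Δ′(U)` (`hessOp`; `B9Ineq369CurvatureSmall`
gives its FORM bound — a one-line add-on, not done here), the tower, print's sup-norm ∕ decay statements (Thm 3.3), the gauge step of p. 416.
HONEST SCOPE.  [folklore] finite-dimensional quadratic-form bookkeeping reproducing the MECHANISM of (3.84) ∕ p. 416 in the form sense for the chain's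
own letters; the novelty w.r.t. (C2)∕(C2′) is only WHERE the perturbation is taken (form vs operator), which is what removes one `‖η⁻¹‖`; nothing of
[B9] asserted; «NE9 ⇐ the named binders»; NE9 NOT PRINTED ∕ NOT PROVED; NOT summit progress (cell pub-balaban: spine PROVED 0/9; rung (B)+1 finite T⁴ —
NOT infinite volume, NOT mass gap, NOT Clay; HONEST DEPENDENCY: continuum YM on T⁴ ⇐ BetaPertH ∧ nine spine estimates (0/9 proved); BetaPertH ⇐ (D1) ∧
(D4) ∧ CAP+tail; G-an2-4 gates asym, D1 and NE2/3/4).  Unit `b2b-balaban-t4-ne9-formalise-leaf-03` (NE9 crux-team leaf prover, gen 62), INTENT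
I-ne9leaf03-g62-2 = ROUTES-NE9 v13.19 R2′ STEP B7′ S1 + S4 (one step; hand-off [NE9IDEA1-G82-INBOX]: first refusals ne9-leaf-04 (S1), OWNER t4-ne9-p1 (S4),
honoured); NEW file importing (S0) + `B9Eq373DerivativeRemainderL2` + `B9Eq368ProjectionRemainder`; modifies nothing.  Net new unproved facts: 0.
-/

noncomputable section

open scoped BigOperators InnerProductSpace ComplexConjugate

namespace Literature.MathematicalPhysics.QuantumFieldTheory.Balaban1983to89.B9Eq382FormRelativeNearFlat

open B4Sect5Torus (TSite)
open B9SectCLatticeCarrier (Bond)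
open B9Eq319QprimeTorus (fineP)
open B11Eq103H1Complex (SiteL2K BondL2K covDivL2K laplaceALatticeK adjoint_covDerivL2K)
open B9Eq310HessianOperator (adTransportW principalOpK covCurlL2K principalOpK_eq_comp inner_covCoCurlL2K_covCurlL2K)
open B9Eq326OperatorAssembly (RofU)
open B9Eq315QTorus (perCfg cornerSite QtorusW)
open B7Prop1Explicit (U1 Wcx boxVec)
open B5Eq172HodgePositivity (conj_inv_ofReal laplaceALatticeK_RLatticeK_eq re_inner_laplaceAK_projR adTransportW_one adTransportW_inv_one hRS_one)
open B5Eq172FlatCoercivity (hU1_one hreg_one)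
open B5Eq190FlatCoercivityUniform (re_inner_flat_eq_three_sq)
open B5Eq190FlatStrongFormTransfer (flat_strong_coercive_canonical)
open B9Eq373DerivativeRemainderL2 (norm_covCurlL2K_sub_le norm_covDivL2K_sub_le)
open B9Eq368ProjectionRemainder (norm_projR_le)

/-! ## §1 The abstract Kato step and the algebra of squares -/

section Abstract

variable {𝕜 : Type*} [RCLike 𝕜] {E : Type*} [NormedAddCommGroup E] [InnerProductSpace 𝕜 E]

/-- **THE FORM-RELATIVE (KATO-TYPE) NEAR-FLAT STEP**, three lines: if `γ·N(x) ≤ re⟨x, T₁x⟩` and `re⟨x, T₁x⟩ − θ·N(x) ≤ re⟨x, Tx⟩` for all `x`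
(`N` any real functional — here the strong `+1`-form `‖D_1x‖² + ‖D*_1x‖² + ‖x‖²`), then `(γ − θ)·N(x) ≤ re⟨x, Tx⟩`. [folklore]
[cite: Balaban1985BackgroundPropagators, (3.84)–(3.86) p.407, Thm 3.11 p.416] -/
theorem coercive_of_form_near (T T₁ : E →ₗ[𝕜] E) (N : E → ℝ) {γ θ : ℝ}
    (hT₁ : ∀ x, γ * N x ≤ RCLike.re ⟪x, T₁ x⟫_𝕜) (hnear : ∀ x, RCLike.re ⟪x, T₁ x⟫_𝕜 - θ * N x ≤ RCLike.re ⟪x, T x⟫_𝕜) (x : E) :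
    (γ - θ) * N x ≤ RCLike.re ⟪x, T x⟫_𝕜 := by
  have h1 := hT₁ x
  have h2 := hnear x
  nlinarith

omit [InnerProductSpace 𝕜 E] in
/-- **A SQUARE DROPS BY AT MOST `‖u − v‖·(2‖v‖ + ‖u − v‖)`**: `‖v‖² − ‖u‖² ≤ ‖u − v‖·(2‖v‖ + ‖u − v‖)` — the one inequality the form-relative
step uses on each of the three squares of (1.69). [folklore] [cite: Balaban1984PropagatorsI, (1.69) p.29] -/
theorem norm_sq_sub_le (u v : E) : ‖v‖ ^ 2 - ‖u‖ ^ 2 ≤ ‖u - v‖ * (2 * ‖v‖ + ‖u - v‖) := by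
  have h1 : ‖v‖ - ‖u‖ ≤ ‖u - v‖ := by
    rw [norm_sub_rev]; exact (le_abs_self _).trans (abs_norm_sub_norm_le v u)
  have h2 : ‖u‖ ≤ ‖v‖ + ‖u - v‖ := by
    calc ‖u‖ = ‖v + (u - v)‖ := by rw [add_sub_cancel]
      _ ≤ ‖v‖ + ‖u - v‖ := norm_add_le _ _
  have i1 := mul_le_mul_of_nonneg_right h1 (add_nonneg (norm_nonneg v) (norm_nonneg u))
  have i2 := mul_le_mul_of_nonneg_left h2 (norm_nonneg (u - v))
  nlinarith [i1, i2]

/-- `2st ≤ s² + t²`. [folklore] -/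
private theorem two_mul_le_sq_add_sq (s t : ℝ) : 2 * s * t ≤ s ^ 2 + t ^ 2 := by nlinarith [sq_nonneg (s - t)]

end Abstract

/-! ## §2 (1.69) AT the background `U`: the three squares of the chain's principal gauge-fixed form -/

section ThreeSquares

variable {d : ℕ} (L : ℕ) [NeZero L] (m : Fin d → ℕ) [∀ i, NeZero (fineP L m i)] (hL : 1 ≤ L) {c₀ c₁ : ℝ} [Fact (0 < c₀)] [Fact (0 < c₁)]
  {𝔸 : Type*} [NormedRing 𝔸] [NormedAlgebra ℂ 𝔸] [CompleteSpace 𝔸] [NormOneClass 𝔸]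
  {W : Type*} [NormedAddCommGroup W] [InnerProductSpace ℂ W] [FiniteDimensional ℂ W] (φ : W ≃ₗ[ℂ] 𝔸)
  (η : ℝ) (a : ℝ) (U : Bond d (fineP L m) → 𝔸ˣ) {α : ℝ} (hα1 : α ≤ 1 / 64)
  (hU1 : ∀ (x : B7Prop1Explicit.Site d) (κ : Fin d), perCfg (fineP L m) U x κ ∈ U1 𝔸)
  (hreg : ∀ (y : TSite d m) (κ : Fin d) (r : Fin d → Fin L), ‖((Wcx L (perCfg (fineP L m) U) (cornerSite L y) κ (boxVec L r) : 𝔸ˣ) : 𝔸) - 1‖ ≤ α)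
  (hRS : ∀ (b : Bond d (fineP L m)) (v u : W), ⟪adTransportW φ U b v, u⟫_ℂ = ⟪v, adTransportW φ (fun b => (U b)⁻¹) b u⟫_ℂ)

include hRS

omit [NeZero L] [∀ i, NeZero (fineP L m i)] [CompleteSpace 𝔸] [NormOneClass 𝔸] in
/-- **`re⟨x, D*D(U)x⟩ = ‖D_Ux‖²`** under the mutual adjointness `hRS` of the transporters read on the fibre (`B9Eq310HessianOperator.principalOpK_eq_comp`
+ `inner_covCoCurlL2K_covCurlL2K`); `B5Eq172HodgePositivity.re_inner_principalOpK_one` is the case `U = 1`. [cite: Balaban1985BackgroundPropagators, (3.10) p.392] -/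
theorem re_inner_principalOpK_eq (x : BondL2K ℂ d (fineP L m) c₀ W) :
    RCLike.re ⟪x, principalOpK φ η U x⟫_ℂ = ‖covCurlL2K ℂ c₀ ((η : ℂ))⁻¹ (adTransportW φ U) x‖ ^ 2 := by
  rw [principalOpK_eq_comp, LinearMap.comp_apply, inner_covCoCurlL2K_covCurlL2K _ (conj_inv_ofReal η) _ _ hRS, ← RCLike.ofReal_pow,
    RCLike.ofReal_re]

/-- **(1.69) AT THE BACKGROUND `U` — THREE SQUARES**: `re⟨x, (D*D + D R(U) D* + aQ(U)†Q(U)) x⟩ = ‖D_Ux‖² + ‖R(U)D*_Ux‖² + a‖Q(U)x‖²` for the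
chain's letters at `U` (`B5Eq172HodgePositivity.laplaceALatticeK_RLatticeK_eq` + `re_inner_laplaceAK_projR`, `D* = D†` under `hRS`); (F)'s
`re_inner_flat_eq_three_sq` is the case `U = 1`. [cite: Balaban1984PropagatorsI, (1.69) p.29; Balaban1985BackgroundPropagators, (3.10) p.392, (3.26) p.395] -/
theorem re_inner_laplaceA_eq_three_sq (x : BondL2K ℂ d (fineP L m) c₀ W) :
    RCLike.re ⟪x, laplaceALatticeK ((η : ℂ))⁻¹ (adTransportW φ U) (adTransportW φ fun b => (U b)⁻¹) (principalOpK φ η U) (RofU L m φ η U)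
        (QtorusW L m hL φ U hα1 hU1 hreg (c₁ := c₁)) a x⟫_ℂ =
      ‖covCurlL2K ℂ c₀ ((η : ℂ))⁻¹ (adTransportW φ U) x‖ ^ 2 +
        ‖RofU L m φ η U (covDivL2K ℂ c₀ ((η : ℂ))⁻¹ (adTransportW φ fun b => (U b)⁻¹) x)‖ ^ 2 +
          a * ‖QtorusW L m hL φ U hα1 hU1 hreg (c₁ := c₁) x‖ ^ 2 := by
  have hc : conj (((η : ℂ))⁻¹) = ((η : ℂ))⁻¹ := conj_inv_ofReal η
  unfold RofU
  rw [laplaceALatticeK_RLatticeK_eq _ hc _ _ hRS, re_inner_laplaceAK_projR, adjoint_covDerivL2K _ hc _ _ hRS, re_inner_principalOpK_eq L m φ η U hRS]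
  rfl

end ThreeSquares

/-! ## §3 The form-relative near-flat step at the chain's letters (letter defects DISPLAYED) -/

section Near

variable {d : ℕ} (L : ℕ) [NeZero L] (m : Fin d → ℕ) [∀ i, NeZero (fineP L m i)] (hL : 1 ≤ L) {c₀ c₁ : ℝ} [Fact (0 < c₀)] [Fact (0 < c₁)]
  {𝔸 : Type*} [NormedRing 𝔸] [NormedAlgebra ℂ 𝔸] [CompleteSpace 𝔸] [NormOneClass 𝔸]
  {W : Type*} [NormedAddCommGroup W] [InnerProductSpace ℂ W] [FiniteDimensional ℂ W] (φ : W ≃ₗ[ℂ] 𝔸)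
  (η : ℝ) {a : ℝ} (ha : 0 ≤ a) (U : Bond d (fineP L m) → 𝔸ˣ) {α : ℝ} (hα1 : α ≤ 1 / 64)
  (hU1 : ∀ (x : B7Prop1Explicit.Site d) (κ : Fin d), perCfg (fineP L m) U x κ ∈ U1 𝔸)
  (hreg : ∀ (y : TSite d m) (κ : Fin d) (r : Fin d → Fin L), ‖((Wcx L (perCfg (fineP L m) U) (cornerSite L y) κ (boxVec L r) : 𝔸ˣ) : 𝔸) - 1‖ ≤ α)
  (hRS : ∀ (b : Bond d (fineP L m)) (v u : W), ⟪adTransportW φ U b v, u⟫_ℂ = ⟪v, adTransportW φ (fun b => (U b)⁻¹) b u⟫_ℂ)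
  {δD δS δR δQ MQ : ℝ} (hδD : 0 ≤ δD) (hδS : 0 ≤ δS) (hδR : 0 ≤ δR) (hδQ : 0 ≤ δQ)
  (hD : ∀ x : BondL2K ℂ d (fineP L m) c₀ W, ‖covCurlL2K ℂ c₀ ((η : ℂ))⁻¹ (adTransportW φ U) x -
    covCurlL2K ℂ c₀ ((η : ℂ))⁻¹ (adTransportW φ (fun _ : Bond d (fineP L m) => (1 : 𝔸ˣ))) x‖ ≤ δD * ‖x‖)
  (hS : ∀ x : BondL2K ℂ d (fineP L m) c₀ W, ‖covDivL2K ℂ c₀ ((η : ℂ))⁻¹ (adTransportW φ fun b => (U b)⁻¹) x -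
    covDivL2K ℂ c₀ ((η : ℂ))⁻¹ (adTransportW φ fun _ : Bond d (fineP L m) => (1 : 𝔸ˣ)⁻¹) x‖ ≤ δS * ‖x‖)
  (hR : ∀ y : SiteL2K ℂ d (fineP L m) c₀ W, ‖RofU L m φ η U y - RofU L m φ η (fun _ : Bond d (fineP L m) => (1 : 𝔸ˣ)) y‖ ≤ δR * ‖y‖)
  (hQ : ∀ x : BondL2K ℂ d (fineP L m) c₀ W, ‖QtorusW L m hL φ U hα1 hU1 hreg (c₁ := c₁) x -
    QtorusW L m hL φ (fun _ => 1) (show (0 : ℝ) ≤ 1 / 64 by norm_num) (hU1_one L m) (hreg_one L m) (c₁ := c₁) x‖ ≤ δQ * ‖x‖)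
  (hQ₁ : ∀ x : BondL2K ℂ d (fineP L m) c₀ W,
    ‖QtorusW L m hL φ (fun _ => 1) (show (0 : ℝ) ≤ 1 / 64 by norm_num) (hU1_one L m) (hreg_one L m) (c₁ := c₁) x‖ ≤ MQ * ‖x‖)

include ha hRS hδD hδS hδR hδQ hD hS hR hQ hQ₁

/-- **THE FORM-RELATIVE NEAR-FLAT STEP FOR THE NE9 CHAIN** ((3.84) ∕ p. 416's mechanism in the FORM sense): with the letter defects DISPLAYED —
curl `δ_D`, divergence `δ_S`, projection `δ_R` (`‖(R(U) − R(1))y‖ ≤ δ_R‖y‖`), averaging `δ_Q` and the flat averaging norm `M_Q` —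
`re⟨x, Δ_a(1)x⟩ − (δ_D·‖D_1x‖² + (δ_S + δ_Sδ_R + 2δ_R + δ_R²)·‖D*_1x‖² + (δ_D + δ_D² + δ_S + δ_Sδ_R + δ_S² + aδ_Q(2M_Q + δ_Q))·‖x‖²) ≤ re⟨x, Δ_a(U)x⟩`.
Proof: §2 at `U` and at `1`, `norm_sq_sub_le` on each square (`‖R(U)‖ ≤ 1`, `B9Eq368ProjectionRemainder.norm_projR_le`), `2st ≤ s² + t²`.
FIRST order in the derivative letters: no `D*D` difference enters. [cite: Balaban1985BackgroundPropagators, (3.82)–(3.86) p.407, Thm 3.11 p.416; Balaban1984PropagatorsI, (1.69) p.29] -/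
theorem re_inner_laplaceA_ge_flat_sub (x : BondL2K ℂ d (fineP L m) c₀ W) :
    RCLike.re ⟪x, laplaceALatticeK ((η : ℂ))⁻¹ (adTransportW φ (fun _ : Bond d (fineP L m) => (1 : 𝔸ˣ)))
          (adTransportW φ fun _ : Bond d (fineP L m) => (1 : 𝔸ˣ)⁻¹) (principalOpK φ η fun _ => 1) (RofU L m φ η fun _ => 1)
          (QtorusW L m hL φ (fun _ => 1) (show (0 : ℝ) ≤ 1 / 64 by norm_num) (hU1_one L m) (hreg_one L m) (c₁ := c₁)) a x⟫_ℂ -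
        (δD * ‖covCurlL2K ℂ c₀ ((η : ℂ))⁻¹ (adTransportW φ (fun _ : Bond d (fineP L m) => (1 : 𝔸ˣ))) x‖ ^ 2 +
          (δS + δS * δR + 2 * δR + δR ^ 2) *
            ‖covDivL2K ℂ c₀ ((η : ℂ))⁻¹ (adTransportW φ fun _ : Bond d (fineP L m) => (1 : 𝔸ˣ)⁻¹) x‖ ^ 2 +
          (δD + δD ^ 2 + δS + δS * δR + δS ^ 2 + a * δQ * (2 * MQ + δQ)) * ‖x‖ ^ 2) ≤
      RCLike.re ⟪x, laplaceALatticeK ((η : ℂ))⁻¹ (adTransportW φ U) (adTransportW φ fun b => (U b)⁻¹) (principalOpK φ η U) (RofU L m φ η U)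
        (QtorusW L m hL φ U hα1 hU1 hreg (c₁ := c₁)) a x⟫_ℂ := by
  rw [re_inner_laplaceA_eq_three_sq L m hL φ η a U hα1 hU1 hreg hRS x,
    re_inner_flat_eq_three_sq L m hL φ (show (0 : ℝ) ≤ 1 / 64 by norm_num) (hU1_one L m) (hreg_one L m) η a x]
  -- names for the six vectors
  set cU := covCurlL2K ℂ c₀ ((η : ℂ))⁻¹ (adTransportW φ U) x with hcU
  set c1 := covCurlL2K ℂ c₀ ((η : ℂ))⁻¹ (adTransportW φ (fun _ : Bond d (fineP L m) => (1 : 𝔸ˣ))) x with hc1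
  set sU := covDivL2K ℂ c₀ ((η : ℂ))⁻¹ (adTransportW φ fun b => (U b)⁻¹) x with hsU
  set s1 := covDivL2K ℂ c₀ ((η : ℂ))⁻¹ (adTransportW φ fun _ : Bond d (fineP L m) => (1 : 𝔸ˣ)⁻¹) x with hs1
  set qU := QtorusW L m hL φ U hα1 hU1 hreg (c₁ := c₁) x with hqU
  set q1 := QtorusW L m hL φ (fun _ => 1) (show (0 : ℝ) ≤ 1 / 64 by norm_num) (hU1_one L m) (hreg_one L m) (c₁ := c₁) x with hq1
  -- the curl square
  have hcurl : ‖c1‖ ^ 2 - ‖cU‖ ^ 2 ≤ δD * ‖x‖ * (2 * ‖c1‖ + δD * ‖x‖) := by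
    have h := norm_sq_sub_le cU c1
    have hd : ‖cU - c1‖ ≤ δD * ‖x‖ := hD x
    have h0 : 0 ≤ ‖cU - c1‖ := norm_nonneg _
    calc ‖c1‖ ^ 2 - ‖cU‖ ^ 2 ≤ ‖cU - c1‖ * (2 * ‖c1‖ + ‖cU - c1‖) := h
      _ ≤ δD * ‖x‖ * (2 * ‖c1‖ + δD * ‖x‖) := mul_le_mul hd (by linarith) (by positivity) (by positivity)
  -- the projected-divergence square: `‖R_U s_U − R_1 s_1‖ ≤ ‖s_U − s_1‖ + ‖(R_U − R_1)s_1‖ ≤ δ_S‖x‖ + δ_R‖s_1‖`, `‖R_1 s_1‖ ≤ ‖s_1‖`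
  have hRU1 : ‖RofU L m φ η U sU - RofU L m φ η (fun _ : Bond d (fineP L m) => (1 : 𝔸ˣ)) s1‖ ≤ δS * ‖x‖ + δR * ‖s1‖ := by
    have hsplit : RofU L m φ η U sU - RofU L m φ η (fun _ : Bond d (fineP L m) => (1 : 𝔸ˣ)) s1 =
        RofU L m φ η U (sU - s1) + (RofU L m φ η U s1 - RofU L m φ η (fun _ : Bond d (fineP L m) => (1 : 𝔸ˣ)) s1) := by
      rw [map_sub]; abel
    rw [hsplit]
    refine (norm_add_le _ _).trans (add_le_add ?_ (hR s1))
    exact (norm_projR_le _ _ _).trans (hS x)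
  have hR1le : ‖RofU L m φ η (fun _ : Bond d (fineP L m) => (1 : 𝔸ˣ)) s1‖ ≤ ‖s1‖ := norm_projR_le _ _ _
  have hproj : ‖RofU L m φ η (fun _ : Bond d (fineP L m) => (1 : 𝔸ˣ)) s1‖ ^ 2 - ‖RofU L m φ η U sU‖ ^ 2 ≤
      (δS * ‖x‖ + δR * ‖s1‖) * (2 * ‖s1‖ + (δS * ‖x‖ + δR * ‖s1‖)) := by
    have h := norm_sq_sub_le (RofU L m φ η U sU) (RofU L m φ η (fun _ : Bond d (fineP L m) => (1 : 𝔸ˣ)) s1)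
    have h0 : 0 ≤ ‖RofU L m φ η U sU - RofU L m φ η (fun _ : Bond d (fineP L m) => (1 : 𝔸ˣ)) s1‖ := norm_nonneg _
    refine h.trans (mul_le_mul hRU1 (by linarith) (by positivity) (by positivity))
  -- the averaging square
  have havg : ‖q1‖ ^ 2 - ‖qU‖ ^ 2 ≤ δQ * ‖x‖ * (2 * (MQ * ‖x‖) + δQ * ‖x‖) := by
    have h := norm_sq_sub_le qU q1
    have hd : ‖qU - q1‖ ≤ δQ * ‖x‖ := hQ x
    have h0 : 0 ≤ ‖qU - q1‖ := norm_nonneg _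
    have hq : ‖q1‖ ≤ MQ * ‖x‖ := hQ₁ x
    refine h.trans (mul_le_mul hd (by linarith) (by positivity) (by positivity))
  -- Young on the cross terms and bookkeeping
  have hy1 := two_mul_le_sq_add_sq ‖x‖ ‖c1‖
  have hy2 := two_mul_le_sq_add_sq ‖x‖ ‖s1‖
  have havg' : a * (‖q1‖ ^ 2 - ‖qU‖ ^ 2) ≤ a * (δQ * ‖x‖ * (2 * (MQ * ‖x‖) + δQ * ‖x‖)) := mul_le_mul_of_nonneg_left havg ha
  have p1 : δD * (2 * ‖x‖ * ‖c1‖) ≤ δD * (‖x‖ ^ 2 + ‖c1‖ ^ 2) := mul_le_mul_of_nonneg_left hy1 hδD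
  have p2 : δS * (2 * ‖x‖ * ‖s1‖) ≤ δS * (‖x‖ ^ 2 + ‖s1‖ ^ 2) := mul_le_mul_of_nonneg_left hy2 hδS
  have p3 : δS * δR * (2 * ‖x‖ * ‖s1‖) ≤ δS * δR * (‖x‖ ^ 2 + ‖s1‖ ^ 2) := mul_le_mul_of_nonneg_left hy2 (mul_nonneg hδS hδR)
  -- linear bookkeeping in the monomials
  have hcurl' : ‖c1‖ ^ 2 - ‖cU‖ ^ 2 ≤ δD * ‖c1‖ ^ 2 + (δD + δD ^ 2) * ‖x‖ ^ 2 := by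
    have e1 : δD * ‖x‖ * (2 * ‖c1‖ + δD * ‖x‖) = δD * (2 * ‖x‖ * ‖c1‖) + δD ^ 2 * ‖x‖ ^ 2 := by ring
    have e2 : δD * (‖x‖ ^ 2 + ‖c1‖ ^ 2) = δD * ‖c1‖ ^ 2 + δD * ‖x‖ ^ 2 := by ring
    linarith [hcurl, p1, e1, e2]
  have hproj' : ‖RofU L m φ η (fun _ : Bond d (fineP L m) => (1 : 𝔸ˣ)) s1‖ ^ 2 - ‖RofU L m φ η U sU‖ ^ 2 ≤
      (δS + δS * δR + 2 * δR + δR ^ 2) * ‖s1‖ ^ 2 + (δS + δS * δR + δS ^ 2) * ‖x‖ ^ 2 := by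
    have e1 : (δS * ‖x‖ + δR * ‖s1‖) * (2 * ‖s1‖ + (δS * ‖x‖ + δR * ‖s1‖)) =
        δS * (2 * ‖x‖ * ‖s1‖) + δS * δR * (2 * ‖x‖ * ‖s1‖) + δS ^ 2 * ‖x‖ ^ 2 + (2 * δR + δR ^ 2) * ‖s1‖ ^ 2 := by ring
    have e2 : (δS + δS * δR + 2 * δR + δR ^ 2) * ‖s1‖ ^ 2 + (δS + δS * δR + δS ^ 2) * ‖x‖ ^ 2 =
        δS * (‖x‖ ^ 2 + ‖s1‖ ^ 2) + δS * δR * (‖x‖ ^ 2 + ‖s1‖ ^ 2) + δS ^ 2 * ‖x‖ ^ 2 + (2 * δR + δR ^ 2) * ‖s1‖ ^ 2 := by ring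
    linarith [hproj, p2, p3, e1, e2]
  have havg'' : a * ‖q1‖ ^ 2 - a * ‖qU‖ ^ 2 ≤ a * δQ * (2 * MQ + δQ) * ‖x‖ ^ 2 := by
    have e1 : a * (δQ * ‖x‖ * (2 * (MQ * ‖x‖) + δQ * ‖x‖)) = a * δQ * (2 * MQ + δQ) * ‖x‖ ^ 2 := by ring
    have e2 : a * (‖q1‖ ^ 2 - ‖qU‖ ^ 2) = a * ‖q1‖ ^ 2 - a * ‖qU‖ ^ 2 := by ring
    linarith [havg', e1, e2]
  have e3 : (δD + δD ^ 2 + δS + δS * δR + δS ^ 2 + a * δQ * (2 * MQ + δQ)) * ‖x‖ ^ 2 =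
      (δD + δD ^ 2) * ‖x‖ ^ 2 + (δS + δS * δR + δS ^ 2) * ‖x‖ ^ 2 + a * δQ * (2 * MQ + δQ) * ‖x‖ ^ 2 := by ring
  linarith [hcurl', hproj', havg'', e3]

end Near

/-! ## §4 The derivative defects DISCHARGED from the transporter closeness: `δ_D = 4√d‖η⁻¹‖εR`, `δ_S = √d‖η⁻¹‖εR` (first order, one `‖η⁻¹‖`) -/

section Transport

variable {d : ℕ} (L : ℕ) [NeZero L] (m : Fin d → ℕ) [∀ i, NeZero (fineP L m i)] (hL : 1 ≤ L) {c₀ c₁ : ℝ} [Fact (0 < c₀)] [Fact (0 < c₁)]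
  {𝔸 : Type*} [NormedRing 𝔸] [NormedAlgebra ℂ 𝔸] [CompleteSpace 𝔸] [NormOneClass 𝔸]
  {W : Type*} [NormedAddCommGroup W] [InnerProductSpace ℂ W] [FiniteDimensional ℂ W] (φ : W ≃ₗ[ℂ] 𝔸)
  (η : ℝ) {a : ℝ} (ha : 0 ≤ a) (U : Bond d (fineP L m) → 𝔸ˣ) {α : ℝ} (hα1 : α ≤ 1 / 64)
  (hU1 : ∀ (x : B7Prop1Explicit.Site d) (κ : Fin d), perCfg (fineP L m) U x κ ∈ U1 𝔸)
  (hreg : ∀ (y : TSite d m) (κ : Fin d) (r : Fin d → Fin L), ‖((Wcx L (perCfg (fineP L m) U) (cornerSite L y) κ (boxVec L r) : 𝔸ˣ) : 𝔸) - 1‖ ≤ α)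
  (hRS : ∀ (b : Bond d (fineP L m)) (v u : W), ⟪adTransportW φ U b v, u⟫_ℂ = ⟪v, adTransportW φ (fun b => (U b)⁻¹) b u⟫_ℂ)
  {εR δR δQ MQ : ℝ} (hεR : 0 ≤ εR) (hδR : 0 ≤ δR) (hδQ : 0 ≤ δQ)
  (hRε : ∀ (b : Bond d (fineP L m)) (w : W), ‖adTransportW φ U b w - w‖ ≤ εR * ‖w‖)
  (hR : ∀ y : SiteL2K ℂ d (fineP L m) c₀ W, ‖RofU L m φ η U y - RofU L m φ η (fun _ : Bond d (fineP L m) => (1 : 𝔸ˣ)) y‖ ≤ δR * ‖y‖)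
  (hQ : ∀ x : BondL2K ℂ d (fineP L m) c₀ W, ‖QtorusW L m hL φ U hα1 hU1 hreg (c₁ := c₁) x -
    QtorusW L m hL φ (fun _ => 1) (show (0 : ℝ) ≤ 1 / 64 by norm_num) (hU1_one L m) (hreg_one L m) (c₁ := c₁) x‖ ≤ δQ * ‖x‖)
  (hQ₁ : ∀ x : BondL2K ℂ d (fineP L m) c₀ W,
    ‖QtorusW L m hL φ (fun _ => 1) (show (0 : ℝ) ≤ 1 / 64 by norm_num) (hU1_one L m) (hreg_one L m) (c₁ := c₁) x‖ ≤ MQ * ‖x‖)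

include ha hRS hεR hδR hδQ hRε hR hQ hQ₁

/-- **§3 WITH THE DERIVATIVE DEFECTS DISCHARGED** from the transporter closeness `‖R(U(b))w − w‖ ≤ εR‖w‖` (displayed; (C2) derives `εR = K_R·ε`):
`δ_D = 4√d·‖η⁻¹‖·εR` (`B9Eq373DerivativeRemainderL2.norm_covCurlL2K_sub_le`), `δ_S = √d·‖η⁻¹‖·εR` (`norm_covDivL2K_sub_le`) — ONE `‖η⁻¹‖` each, so
at print's η-scaled window (`εR = K_R·αη`) both are η-FREE (`4√dK_Rα`, `√dK_Rα`); `δ_R`, `δ_Q`, `M_Q` stay displayed.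
[cite: Balaban1985BackgroundPropagators, (3.70)–(3.73) pp.404–405, (3.82)–(3.86) p.407, Thm 3.11 p.416] -/
theorem re_inner_laplaceA_ge_flat_sub_of_transport (x : BondL2K ℂ d (fineP L m) c₀ W) :
    RCLike.re ⟪x, laplaceALatticeK ((η : ℂ))⁻¹ (adTransportW φ (fun _ : Bond d (fineP L m) => (1 : 𝔸ˣ)))
          (adTransportW φ fun _ : Bond d (fineP L m) => (1 : 𝔸ˣ)⁻¹) (principalOpK φ η fun _ => 1) (RofU L m φ η fun _ => 1)
          (QtorusW L m hL φ (fun _ => 1) (show (0 : ℝ) ≤ 1 / 64 by norm_num) (hU1_one L m) (hreg_one L m) (c₁ := c₁)) a x⟫_ℂ -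
        ((4 * Real.sqrt d * (‖((η : ℂ))⁻¹‖ * εR)) * ‖covCurlL2K ℂ c₀ ((η : ℂ))⁻¹ (adTransportW φ (fun _ : Bond d (fineP L m) => (1 : 𝔸ˣ))) x‖ ^ 2 +
          ((‖((η : ℂ))⁻¹‖ * εR * Real.sqrt d) + (‖((η : ℂ))⁻¹‖ * εR * Real.sqrt d) * δR + 2 * δR + δR ^ 2) *
            ‖covDivL2K ℂ c₀ ((η : ℂ))⁻¹ (adTransportW φ fun _ : Bond d (fineP L m) => (1 : 𝔸ˣ)⁻¹) x‖ ^ 2 +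
          ((4 * Real.sqrt d * (‖((η : ℂ))⁻¹‖ * εR)) + (4 * Real.sqrt d * (‖((η : ℂ))⁻¹‖ * εR)) ^ 2 + (‖((η : ℂ))⁻¹‖ * εR * Real.sqrt d) +
              (‖((η : ℂ))⁻¹‖ * εR * Real.sqrt d) * δR + (‖((η : ℂ))⁻¹‖ * εR * Real.sqrt d) ^ 2 + a * δQ * (2 * MQ + δQ)) * ‖x‖ ^ 2) ≤
      RCLike.re ⟪x, laplaceALatticeK ((η : ℂ))⁻¹ (adTransportW φ U) (adTransportW φ fun b => (U b)⁻¹) (principalOpK φ η U) (RofU L m φ η U)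
        (QtorusW L m hL φ U hα1 hU1 hreg (c₁ := c₁)) a x⟫_ℂ := by
  have hc : conj (((η : ℂ))⁻¹) = ((η : ℂ))⁻¹ := conj_inv_ofReal η
  have hR₁ : ∀ (b : Bond d (fineP L m)) (w : W), adTransportW φ (fun _ : Bond d (fineP L m) => (1 : 𝔸ˣ)) b w = w := fun b w => by
    rw [adTransportW_one]; rfl
  have hS₁ : ∀ (b : Bond d (fineP L m)) (w : W), adTransportW φ (fun _ : Bond d (fineP L m) => (1 : 𝔸ˣ)⁻¹) b w = w := fun b w => by
    rw [adTransportW_inv_one]; rfl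
  have hD : ∀ y : BondL2K ℂ d (fineP L m) c₀ W, ‖covCurlL2K ℂ c₀ ((η : ℂ))⁻¹ (adTransportW φ U) y -
      covCurlL2K ℂ c₀ ((η : ℂ))⁻¹ (adTransportW φ (fun _ : Bond d (fineP L m) => (1 : 𝔸ˣ))) y‖ ≤ (4 * Real.sqrt d * (‖((η : ℂ))⁻¹‖ * εR)) * ‖y‖ :=
    fun y => norm_covCurlL2K_sub_le _ hεR hRε hR₁ y
  have hSd : ∀ y : BondL2K ℂ d (fineP L m) c₀ W, ‖covDivL2K ℂ c₀ ((η : ℂ))⁻¹ (adTransportW φ fun b => (U b)⁻¹) y -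
      covDivL2K ℂ c₀ ((η : ℂ))⁻¹ (adTransportW φ fun _ : Bond d (fineP L m) => (1 : 𝔸ˣ)⁻¹) y‖ ≤ (‖((η : ℂ))⁻¹‖ * εR * Real.sqrt d) * ‖y‖ :=
    fun y => norm_covDivL2K_sub_le _ hc hεR hRε hR₁ hRS hS₁ y
  exact re_inner_laplaceA_ge_flat_sub L m hL φ η ha U hα1 hU1 hreg hRS (by positivity) (by positivity) hδR hδQ hD hSd hR hQ hQ₁ x

end Transport

/-! ## §5 Composition with (S0): STRONG coercivity at `U` along Bałaban's normalisation, form-relative -/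

section Strong

variable {d : ℕ} (L : ℕ) [NeZero L] (m : Fin d → ℕ) [∀ i, NeZero (fineP L m i)] (hL : 1 ≤ L) {c₀ c₁ : ℝ} [Fact (0 < c₀)] [Fact (0 < c₁)]
  {𝔸 : Type*} [NormedRing 𝔸] [NormedAlgebra ℂ 𝔸] [CompleteSpace 𝔸] [NormOneClass 𝔸]
  {W : Type*} [NormedAddCommGroup W] [InnerProductSpace ℂ W] [FiniteDimensional ℂ W] (φ : W ≃ₗ[ℂ] 𝔸)
  {η : ℝ} {a : ℝ} (ha : 0 < a) (U : Bond d (fineP L m) → 𝔸ˣ) {α : ℝ} (hα1 : α ≤ 1 / 64)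
  (hU1 : ∀ (x : B7Prop1Explicit.Site d) (κ : Fin d), perCfg (fineP L m) U x κ ∈ U1 𝔸)
  (hreg : ∀ (y : TSite d m) (κ : Fin d) (r : Fin d → Fin L), ‖((Wcx L (perCfg (fineP L m) U) (cornerSite L y) κ (boxVec L r) : 𝔸ˣ) : 𝔸) - 1‖ ≤ α)
  (hRS : ∀ (b : Bond d (fineP L m)) (v u : W), ⟪adTransportW φ U b v, u⟫_ℂ = ⟪v, adTransportW φ (fun b => (U b)⁻¹) b u⟫_ℂ)
  {εR δR δQ MQ : ℝ} (hεR : 0 ≤ εR) (hδR : 0 ≤ δR) (hδQ : 0 ≤ δQ) (hMQ : 0 ≤ MQ)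
  (hRε : ∀ (b : Bond d (fineP L m)) (w : W), ‖adTransportW φ U b w - w‖ ≤ εR * ‖w‖)
  (hR : ∀ y : SiteL2K ℂ d (fineP L m) c₀ W, ‖RofU L m φ η U y - RofU L m φ η (fun _ : Bond d (fineP L m) => (1 : 𝔸ˣ)) y‖ ≤ δR * ‖y‖)
  (hQ : ∀ x : BondL2K ℂ d (fineP L m) c₀ W, ‖QtorusW L m hL φ U hα1 hU1 hreg (c₁ := c₁) x -
    QtorusW L m hL φ (fun _ => 1) (show (0 : ℝ) ≤ 1 / 64 by norm_num) (hU1_one L m) (hreg_one L m) (c₁ := c₁) x‖ ≤ δQ * ‖x‖)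
  (hQ₁ : ∀ x : BondL2K ℂ d (fineP L m) c₀ W,
    ‖QtorusW L m hL φ (fun _ => 1) (show (0 : ℝ) ≤ 1 / 64 by norm_num) (hU1_one L m) (hreg_one L m) (c₁ := c₁) x‖ ≤ MQ * ‖x‖)

include ha hRS hεR hδR hδQ hMQ hRε hR hQ hQ₁

/-- **STRONG COERCIVITY AT A NEAR-FLAT BACKGROUND, FORM-RELATIVE, ALONG BAŁABAN's NORMALISATION** (`c₁(ηL)² = c₀L^d`, `0 < ηL ≤ 1`): with
`t := ‖η⁻¹‖·εR` and the displayed `δ_R, δ_Q, M_Q`,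
`(γ(d,a) − θ)·(‖D_1x‖² + ‖D*_1x‖² + ‖x‖²) ≤ re⟨x, Δ_a(U)x⟩`, `γ(d,a) = 1∕((d+1)·Cst d a)` ((S0) `flat_strong_coercive_canonical`),
`θ = 4√d·t + 16d·t² + √d·t + √d·t·δ_R + d·t² + 2δ_R + δ_R² + aδ_Q(2M_Q + δ_Q)` — §1's Kato step on §4; NO `‖η⁻¹‖²`, no volume, no block size,
no `∃`-threshold: an inequality holding for all values of the letters (useful when `θ < γ(d,a)`).  This is R2′ STEP B7′ (B7′-1)'s SHAPE for one averaging
step, modulo the discharge of `δ_R` (S3) and of `δ_Q` at `ε = αη` (S2). [cite: Balaban1985BackgroundPropagators, Thm 3.11 p.416, (3.82)–(3.86) p.407; Balaban1984PropagatorsI, Prop. 1.1 (1.90) p.33, (1.69) p.29] -/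
theorem strong_coercive_of_form_near_flat_canonical (hηL0 : 0 < η * L) (hηL1 : η * L ≤ 1) (hs : c₁ * (η * L) ^ 2 = c₀ * (L : ℝ) ^ d)
    (x : BondL2K ℂ d (fineP L m) c₀ W) :
    (1 / ((d + 1 : ℝ) * B5Prop11Plancherel.Cst d a) -
        (4 * Real.sqrt d * (‖((η : ℂ))⁻¹‖ * εR) + (4 * Real.sqrt d * (‖((η : ℂ))⁻¹‖ * εR)) ^ 2 + ‖((η : ℂ))⁻¹‖ * εR * Real.sqrt d +
          ‖((η : ℂ))⁻¹‖ * εR * Real.sqrt d * δR + (‖((η : ℂ))⁻¹‖ * εR * Real.sqrt d) ^ 2 + 2 * δR + δR ^ 2 + a * δQ * (2 * MQ + δQ))) *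
        (‖covCurlL2K ℂ c₀ ((η : ℂ))⁻¹ (adTransportW φ (fun _ : Bond d (fineP L m) => (1 : 𝔸ˣ))) x‖ ^ 2 +
          ‖covDivL2K ℂ c₀ ((η : ℂ))⁻¹ (adTransportW φ fun _ : Bond d (fineP L m) => (1 : 𝔸ˣ)⁻¹) x‖ ^ 2 + ‖x‖ ^ 2) ≤
      RCLike.re ⟪x, laplaceALatticeK ((η : ℂ))⁻¹ (adTransportW φ U) (adTransportW φ fun b => (U b)⁻¹) (principalOpK φ η U) (RofU L m φ η U)
        (QtorusW L m hL φ U hα1 hU1 hreg (c₁ := c₁)) a x⟫_ℂ := by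
  have hflat := flat_strong_coercive_canonical L m hL φ (c₁ := c₁) (show (0 : ℝ) ≤ 1 / 64 by norm_num) (hU1_one L m) (hreg_one L m) ha
    hηL0 hηL1 hs x
  have hnear := re_inner_laplaceA_ge_flat_sub_of_transport L m hL φ η ha.le U hα1 hU1 hreg hRS hεR hδR hδQ hRε hR hQ hQ₁ x
  have hd0 : (0 : ℝ) ≤ Real.sqrt d := Real.sqrt_nonneg _
  have ht0 : 0 ≤ ‖((η : ℂ))⁻¹‖ * εR := mul_nonneg (norm_nonneg _) hεR
  have hC0 : 0 ≤ ‖covCurlL2K ℂ c₀ ((η : ℂ))⁻¹ (adTransportW φ (fun _ : Bond d (fineP L m) => (1 : 𝔸ˣ))) x‖ ^ 2 := sq_nonneg _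
  have hS0 : 0 ≤ ‖covDivL2K ℂ c₀ ((η : ℂ))⁻¹ (adTransportW φ fun _ : Bond d (fineP L m) => (1 : 𝔸ˣ)⁻¹) x‖ ^ 2 := sq_nonneg _
  have hx0 : 0 ≤ ‖x‖ ^ 2 := sq_nonneg _
  -- each row's coefficient in §4 is at most `θ`; the rest is linear bookkeeping
  nlinarith [hflat, hnear, mul_nonneg (mul_nonneg (by norm_num : (0:ℝ) ≤ 4) hd0) ht0, mul_nonneg (mul_nonneg ht0 hd0) hδR, mul_nonneg ht0 hd0,
    sq_nonneg (4 * Real.sqrt d * (‖((η : ℂ))⁻¹‖ * εR)), sq_nonneg (‖((η : ℂ))⁻¹‖ * εR * Real.sqrt d), hδR, sq_nonneg δR,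
    mul_nonneg (mul_nonneg ha.le hδQ) (by linarith : (0:ℝ) ≤ 2 * MQ + δQ),
    mul_nonneg (mul_nonneg (mul_nonneg (by norm_num : (0:ℝ) ≤ 4) hd0) ht0) hS0, mul_nonneg hδR hC0]

/-- **… HENCE THE WEAK SHAPE (C2)∕(C2′) AND `B9Ineq369CurvatureSmall.hpos_of_principal_coercive` CONSUME**: `(γ(d,a) − θ)·‖x‖² ≤ re⟨x, Δ_a(U)x⟩`
(drop the two derivative squares when `γ(d,a) − θ ≥ 0`; otherwise the left side is `≤ 0 ≤` the form, a sum of three squares by §2).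
[cite: Balaban1985BackgroundPropagators, Thm 3.11 p.416, (3.82)–(3.86) p.407; Balaban1984PropagatorsI, Prop. 1.1 (1.90) p.33] -/
theorem coercive_of_form_near_flat_canonical (hηL0 : 0 < η * L) (hηL1 : η * L ≤ 1) (hs : c₁ * (η * L) ^ 2 = c₀ * (L : ℝ) ^ d)
    (x : BondL2K ℂ d (fineP L m) c₀ W) :
    (1 / ((d + 1 : ℝ) * B5Prop11Plancherel.Cst d a) -
        (4 * Real.sqrt d * (‖((η : ℂ))⁻¹‖ * εR) + (4 * Real.sqrt d * (‖((η : ℂ))⁻¹‖ * εR)) ^ 2 + ‖((η : ℂ))⁻¹‖ * εR * Real.sqrt d +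
          ‖((η : ℂ))⁻¹‖ * εR * Real.sqrt d * δR + (‖((η : ℂ))⁻¹‖ * εR * Real.sqrt d) ^ 2 + 2 * δR + δR ^ 2 + a * δQ * (2 * MQ + δQ))) * ‖x‖ ^ 2 ≤
      RCLike.re ⟪x, laplaceALatticeK ((η : ℂ))⁻¹ (adTransportW φ U) (adTransportW φ fun b => (U b)⁻¹) (principalOpK φ η U) (RofU L m φ η U)
        (QtorusW L m hL φ U hα1 hU1 hreg (c₁ := c₁)) a x⟫_ℂ := by
  have h := strong_coercive_of_form_near_flat_canonical L m hL φ (c₁ := c₁) ha U hα1 hU1 hreg hRS hεR hδR hδQ hMQ hRε hR hQ hQ₁ hηL0 hηL1 hs x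
  have hsq := re_inner_laplaceA_eq_three_sq L m hL φ (c₁ := c₁) η a U hα1 hU1 hreg hRS x
  have hC0 : 0 ≤ ‖covCurlL2K ℂ c₀ ((η : ℂ))⁻¹ (adTransportW φ (fun _ : Bond d (fineP L m) => (1 : 𝔸ˣ))) x‖ ^ 2 := sq_nonneg _
  have hS0 : 0 ≤ ‖covDivL2K ℂ c₀ ((η : ℂ))⁻¹ (adTransportW φ fun _ : Bond d (fineP L m) => (1 : 𝔸ˣ)⁻¹) x‖ ^ 2 := sq_nonneg _
  have hpos : 0 ≤ RCLike.re ⟪x, laplaceALatticeK ((η : ℂ))⁻¹ (adTransportW φ U) (adTransportW φ fun b => (U b)⁻¹) (principalOpK φ η U)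
      (RofU L m φ η U) (QtorusW L m hL φ U hα1 hU1 hreg (c₁ := c₁)) a x⟫_ℂ := by
    rw [hsq]; positivity
  by_cases hγ : 0 ≤ 1 / ((d + 1 : ℝ) * B5Prop11Plancherel.Cst d a) -
        (4 * Real.sqrt d * (‖((η : ℂ))⁻¹‖ * εR) + (4 * Real.sqrt d * (‖((η : ℂ))⁻¹‖ * εR)) ^ 2 + ‖((η : ℂ))⁻¹‖ * εR * Real.sqrt d +
          ‖((η : ℂ))⁻¹‖ * εR * Real.sqrt d * δR + (‖((η : ℂ))⁻¹‖ * εR * Real.sqrt d) ^ 2 + 2 * δR + δR ^ 2 + a * δQ * (2 * MQ + δQ))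
  · exact le_trans (by nlinarith [mul_nonneg hγ hC0, mul_nonneg hγ hS0]) h
  · exact le_trans (mul_nonpos_of_nonpos_of_nonneg (le_of_not_ge hγ) (sq_nonneg _)) hpos

end Strong

end Literature.MathematicalPhysics.QuantumFieldTheory.Balaban1983to89.B9Eq382FormRelativeNearFlat

end
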